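import Mathlib
import HarnessLib
import Summits.AtomisticToContinuum.FouriersLaw.Theses.JunctionLocality
import Summits.AtomisticToContinuum.FouriersLaw.Theorems.JunctionLocalitySuperadditiveResistanceDeviceLiouville
import Summits.AtomisticToContinuum.FouriersLaw.Theorems.JunctionLocalitySuperadditiveResistanceDeviceBlockRestriction
import Summits.AtomisticToContinuum.FouriersLaw.Theorems.JunctionLocalitySuperadditiveResistanceStubBypassBoundAux2

/-!
# Bypass-bound helpers III: the bypass pairing is carried by the junction-forced correction
(helpers `--supports` stmt-AtomisticToContinuum-11748 for stub `stub_bypassBound` of line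
`floating-probe-bypass-laplacian`, crux `JunctionLocality.SuperadditiveResistance`)

First (exact, fixed-`N`) step of the Duhamel-at-the-junction reduction of the BYPASS BOUND
`−K_03 = (γ²/T²)⟨g_0, p_{L−1}² − T⟩_{μ_T} ≤ C₃ K_00 K_33` (`L = N + M`). Let `g_0` be the device's
forward field of the left bath (`L_dev g_0 = −(p_0² − T)`) and `g^{(N)}` a forward field of the left
bath of the BARE `N`-chain (`L_N^{T,T} g^{(N)} = −(p_0² − T)`; in the device the probe on site `N−1`
plays exactly the bare chain's right bath — the first lead's `pinnedChain_device_comp_restrictLeft`).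
Then the correction `δ := g_0 − g^{(N)} ∘ π_N` satisfies

* `deviceGenerator_sub_comp_restrictLeft` — `L_dev δ = −V'(q_N − q_{N−1}) · (∂_{p_{N−1}} g^{(N)}) ∘ π_N`
  pointwise (`V'(r) = r + β r³`): `δ` is the device's response to a source localised AT THE JUNCTION,
  the junction bond force times the bathed-end momentum gradient of the bare block's field;
* `integral_sub_comp_restrictLeft_mul_kin_sub` — `⟨δ, p_{L−1}² − T⟩_{μ_T} = ⟨g_0, p_{L−1}² − T⟩_{μ_T}`:
  by the invisibility lemma of Part II the lifted bare field pairs to ZERO with the right bath's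
  source, so the bypass conductance is EXACTLY `(γ²/T²)⟨δ, p_{L−1}² − T⟩_{μ_T}`.

The mirror statements for the right bath's field `g_3`, the bare right block's right-bath field
`g^{(M)}` (`L_M^{T,T} g^{(M)} = −(p_{M−1}² − T)`) and the left bath's source are proved alongside
(`deviceGenerator_sub_comp_restrictRight`, `integral_sub_comp_restrictRight_mul_kin_sub`; junction
source `+V'(r_J) (∂_{p_N} g^{(M)}) ∘ π'_M`), so that both Duhamel steps of the two-sided reduction
`x = (γ²/T²)⟨V'(r_J)(∂_{p_{N−1}} g^{(N)}) ∘ π_N, g_3 ∘ Π⟩ = …` are available.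

What remains for the stub (not here, not in the tree): the `N`-uniform "double escape" estimate
`(γ²/T²)⟨δ, p_{L−1}² − T⟩ ≤ C₃ K_00 K_33`, i.e. one transmission factor from the smallness of the
junction source (`‖V'(r_J) ∂_{p_{N−1}} g^{(N)}‖ = O(K_00)`, termination-type) and one from the response
of the far bath to a junction source (`O(K_33)`).
-/

noncomputable section

open MeasureTheory Filter Topology
open scoped ContDiff
open Literature.MathematicalPhysics.KineticTheory.HeatConduction
open Summit.AtomisticToContinuum.FouriersLaw.Theorems.SuperadditiveResistance.DeviceLiouville
  (kin deviceGenerator kin_eq_sq deviceGenerator_eq liouvilleOp_sub bathOp_sub)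
open Summit.AtomisticToContinuum.FouriersLaw.Cruxes.SuperadditiveResistance.ThermaliseThenCutProbeInsertion
  (pinnedChain_device_comp_restrictLeft pinnedChain_device_comp_restrictRight)

namespace Summit.AtomisticToContinuum.FouriersLaw.Cruxes.SuperadditiveResistance.FloatingProbeBypassLaplacian

section Junction

variable {ω₂ lam β : ℝ} {N M : ℕ}

/-- The left-block map `π_N` is smooth (it is linear). [folklore] -/
theorem contDiff_restrictLeft {n : WithTop ℕ∞} :
    ContDiff ℝ n (fun y : PhaseSpace (N + M) =>
      ((y.1 ∘ Fin.castAdd M, y.2 ∘ Fin.castAdd M) : PhaseSpace N)) :=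
  (contDiff_pi.2 fun i => (contDiff_apply ℝ ℝ (Fin.castAdd M i)).comp contDiff_fst).prodMk
    (contDiff_pi.2 fun i => (contDiff_apply ℝ ℝ (Fin.castAdd M i)).comp contDiff_snd)

/-- A `Cⁿ` function of the left block, lifted to the device, is `Cⁿ`. [folklore] -/
theorem contDiff_comp_restrictLeft {n : WithTop ℕ∞} {f : PhaseSpace N → ℝ} (hf : ContDiff ℝ n f) :
    ContDiff ℝ n (fun y : PhaseSpace (N + M) => f (y.1 ∘ Fin.castAdd M, y.2 ∘ Fin.castAdd M)) :=
  hf.comp contDiff_restrictLeft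

/-- The left bath's source is the same observable on the block and on the device:
`p_0²` of `π_N x` is `p_0²` of `x` (`N ≥ 1`). [folklore] -/
theorem kin_zero_restrictLeft (hN : 1 ≤ N) (x : PhaseSpace (N + M)) :
    kin N 0 (x.1 ∘ Fin.castAdd M, x.2 ∘ Fin.castAdd M) = kin (N + M) 0 x := by
  rw [kin_eq_sq (show 0 < N by omega), kin_eq_sq (show 0 < N + M by omega)]
  rfl

/-- The right bath's source `kin (N+M) (N+M−1)` is `p_j²` at the right-block site
`j = Fin.natAdd N ⟨M−1, _⟩` (`M ≥ 1`). [folklore] -/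
theorem kin_last_eq_sq_natAdd (hM : 1 ≤ M) (x : PhaseSpace (N + M)) :
    kin (N + M) (N + M - 1) x = x.2 (Fin.natAdd N ⟨M - 1, by omega⟩) ^ 2 := by
  have h : (⟨N + M - 1, by omega⟩ : Fin (N + M)) = Fin.natAdd N ⟨M - 1, by omega⟩ :=
    Fin.ext (by simp; omega)
  rw [kin_eq_sq (show N + M - 1 < N + M by omega), h]

/-- The device generator at equal temperatures is linear (subtraction) on `C²`. [folklore] -/
theorem deviceGenerator_sub (P : OscillatorChain) (T : ℝ) {f g : PhaseSpace (N + M) → ℝ}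
    (hf : ContDiff ℝ 2 f) (hg : ContDiff ℝ 2 g) (x : PhaseSpace (N + M)) :
    deviceGenerator P N M (fun _ => T) (fun y => f y - g y) x =
      deviceGenerator P N M (fun _ => T) f x - deviceGenerator P N M (fun _ => T) g x := by
  rw [deviceGenerator_eq, deviceGenerator_eq, deviceGenerator_eq,
    liouvilleOp_sub (hf.differentiable two_ne_zero) (hg.differentiable two_ne_zero),
    bathOp_sub hf hg]
  ring

/-- **The correction `δ = g_0 − g^{(N)} ∘ π_N` solves the device's Poisson problem with the JUNCTION
source.** For the pinned chain, `N, M ≥ 1`, a `C²` solution `g_0` of `L_dev g_0 = −(p_0² − T)` on the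
device and a `C²` solution `g^{(N)}` of `L_N^{T,T} g^{(N)} = −(p_0² − T)` on the bare left block:
`L_dev (g_0 − g^{(N)} ∘ π_N) = −(r_J + β r_J³) · (∂_{p_{N−1}} g^{(N)}) ∘ π_N`, `r_J = q_N − q_{N−1}`.
[folklore] -/
theorem deviceGenerator_sub_comp_restrictLeft (γ : ℝ) (hN : 1 ≤ N) (hM : 1 ≤ M) (T : ℝ)
    {g₀ : PhaseSpace (N + M) → ℝ} {gN : PhaseSpace N → ℝ} (hg₀ : ContDiff ℝ 2 g₀)
    (hgN : ContDiff ℝ 2 gN)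
    (hpde₀ : ∀ x, deviceGenerator (pinnedChain ω₂ lam β γ) N M (fun _ => T) g₀ x =
      -(kin (N + M) 0 x - T))
    (hpdeN : ∀ y, (pinnedChain ω₂ lam β γ).generator N T T gN y = -(kin N 0 y - T))
    (x : PhaseSpace (N + M)) :
    deviceGenerator (pinnedChain ω₂ lam β γ) N M (fun _ => T)
        (fun y => g₀ y - gN (y.1 ∘ Fin.castAdd M, y.2 ∘ Fin.castAdd M)) x =
      -(((x.1 ⟨N, by omega⟩ - x.1 ⟨N - 1, by omega⟩) +
            β * (x.1 ⟨N, by omega⟩ - x.1 ⟨N - 1, by omega⟩) ^ 3) *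
          partialP ⟨N - 1, by omega⟩ gN (x.1 ∘ Fin.castAdd M, x.2 ∘ Fin.castAdd M)) := by
  have hdev : deviceGenerator (pinnedChain ω₂ lam β γ) N M (fun _ => T)
      (fun y => gN (y.1 ∘ Fin.castAdd M, y.2 ∘ Fin.castAdd M)) x =
      (pinnedChain ω₂ lam β γ).generator N T T gN (x.1 ∘ Fin.castAdd M, x.2 ∘ Fin.castAdd M) +
        ((x.1 ⟨N, by omega⟩ - x.1 ⟨N - 1, by omega⟩) +
            β * (x.1 ⟨N, by omega⟩ - x.1 ⟨N - 1, by omega⟩) ^ 3) *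
          partialP ⟨N - 1, by omega⟩ gN (x.1 ∘ Fin.castAdd M, x.2 ∘ Fin.castAdd M) :=
    pinnedChain_device_comp_restrictLeft ω₂ lam β γ hN hM (fun _ => T) gN x
  rw [deviceGenerator_sub _ T hg₀ (contDiff_comp_restrictLeft hgN), hdev, hpde₀, hpdeN,
    kin_zero_restrictLeft hN]
  ring

/-- **The bypass pairing is carried by the correction.** For the pinned chain's Gibbs state on the
device (`M ≥ 1`, `T > 0`) and `g_0`, `g^{(N)} ∘ π_N ∈ L²(μ_T)`:
`⟨g_0 − g^{(N)} ∘ π_N, p_{L−1}² − T⟩_{μ_T} = ⟨g_0, p_{L−1}² − T⟩_{μ_T}` (`L = N + M`): the lifted bare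
field is invisible to the right bath (Part II). Hence `−K_03 = (γ²/T²)⟨δ, p_{L−1}² − T⟩_{μ_T}` with
`δ` the junction-forced correction of `deviceGenerator_sub_comp_restrictLeft`. [folklore] -/
theorem integral_sub_comp_restrictLeft_mul_kin_sub (hω : 0 < ω₂) (hl : 0 ≤ lam) (hβ : 0 ≤ β)
    (γ : ℝ) (hM : 1 ≤ M) {T : ℝ} (hT : 0 < T) {g₀ : PhaseSpace (N + M) → ℝ}
    {gN : PhaseSpace N → ℝ} (hg₀ : MemLp g₀ 2 ((pinnedChain ω₂ lam β γ).gibbsMeasure (N + M) T))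
    (hgN : MemLp (fun y : PhaseSpace (N + M) => gN (y.1 ∘ Fin.castAdd M, y.2 ∘ Fin.castAdd M)) 2
      ((pinnedChain ω₂ lam β γ).gibbsMeasure (N + M) T)) :
    ∫ x, (g₀ x - gN (x.1 ∘ Fin.castAdd M, x.2 ∘ Fin.castAdd M)) * (kin (N + M) (N + M - 1) x - T)
        ∂((pinnedChain ω₂ lam β γ).gibbsMeasure (N + M) T) =
      ∫ x, g₀ x * (kin (N + M) (N + M - 1) x - T)
        ∂((pinnedChain ω₂ lam β γ).gibbsMeasure (N + M) T) := by
  set j : Fin (N + M) := Fin.natAdd N ⟨M - 1, by omega⟩ with hj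
  have hk : MemLp (fun x : PhaseSpace (N + M) => x.2 j ^ 2 - T) 2
      ((pinnedChain ω₂ lam β γ).gibbsMeasure (N + M) T) := by
    haveI := pinnedChain_isProbabilityMeasure_gibbsMeasure hω hl hβ γ (N + M) hT
    exact (pinnedChain_memLp_two_snd_sq hω hl hβ γ (N + M) hT j).sub (memLp_const T)
  have i0 : Integrable (fun x => g₀ x * (x.2 j ^ 2 - T))
      ((pinnedChain ω₂ lam β γ).gibbsMeasure (N + M) T) := hg₀.integrable_mul hk
  have iN : Integrable (fun x : PhaseSpace (N + M) =>
      gN (x.1 ∘ Fin.castAdd M, x.2 ∘ Fin.castAdd M) * (x.2 j ^ 2 - T))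
      ((pinnedChain ω₂ lam β γ).gibbsMeasure (N + M) T) := hgN.integrable_mul hk
  have hzero : ∫ x, gN (x.1 ∘ Fin.castAdd M, x.2 ∘ Fin.castAdd M) * (x.2 j ^ 2 - T)
      ∂((pinnedChain ω₂ lam β γ).gibbsMeasure (N + M) T) = 0 :=
    integral_comp_restrictLeft_mul_sq_sub hω hl hβ γ hT ⟨M - 1, by omega⟩ hgN
  simp_rw [kin_last_eq_sq_natAdd hM]
  have hsplit : (fun x : PhaseSpace (N + M) =>
      (g₀ x - gN (x.1 ∘ Fin.castAdd M, x.2 ∘ Fin.castAdd M)) * (x.2 j ^ 2 - T)) =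
      fun x => g₀ x * (x.2 j ^ 2 - T) -
        gN (x.1 ∘ Fin.castAdd M, x.2 ∘ Fin.castAdd M) * (x.2 j ^ 2 - T) := by
    funext x; ring
  rw [hsplit, integral_sub i0 iN, hzero, sub_zero]

/-! ### The mirror statements for the right block and the left bath -/

/-- Moving along a left-block momentum direction does not change the right-block coordinates. -/
theorem restrictRight_add_smul_castAdd (i : Fin N) (x : PhaseSpace (N + M)) (t : ℝ) :
    (fun y : PhaseSpace (N + M) => ((y.1 ∘ Fin.natAdd N, y.2 ∘ Fin.natAdd N) : PhaseSpace M))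
        (x + t • ((0, Pi.single (Fin.castAdd M i) 1) : PhaseSpace (N + M))) =
      (x.1 ∘ Fin.natAdd N, x.2 ∘ Fin.natAdd N) := by
  have hne : ∀ k : Fin M, Fin.natAdd N k ≠ Fin.castAdd M i := by
    intro k h
    have := congrArg Fin.val h
    simp at this
    omega
  ext k
  · simp
  · simp [hne k]

/-- The right-block map `π'_M` is smooth (it is linear). [folklore] -/
theorem contDiff_restrictRight {n : WithTop ℕ∞} :
    ContDiff ℝ n (fun y : PhaseSpace (N + M) =>
      ((y.1 ∘ Fin.natAdd N, y.2 ∘ Fin.natAdd N) : PhaseSpace M)) :=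
  (contDiff_pi.2 fun k => (contDiff_apply ℝ ℝ (Fin.natAdd N k)).comp contDiff_fst).prodMk
    (contDiff_pi.2 fun k => (contDiff_apply ℝ ℝ (Fin.natAdd N k)).comp contDiff_snd)

/-- A `Cⁿ` function of the right block, lifted to the device, is `Cⁿ`. [folklore] -/
theorem contDiff_comp_restrictRight {n : WithTop ℕ∞} {f : PhaseSpace M → ℝ} (hf : ContDiff ℝ n f) :
    ContDiff ℝ n (fun y : PhaseSpace (N + M) => f (y.1 ∘ Fin.natAdd N, y.2 ∘ Fin.natAdd N)) :=
  hf.comp contDiff_restrictRight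

/-- **Right-block observables are invisible to the left-block baths**:
`∫ (f ∘ π'_M) (p_i² − T) dμ_T = 0` for every left-block site `i` and `f ∘ π'_M ∈ L²(μ_T)`. [folklore] -/
theorem integral_comp_restrictRight_mul_sq_sub (hω : 0 < ω₂) (hl : 0 ≤ lam) (hβ : 0 ≤ β) (γ : ℝ)
    {T : ℝ} (hT : 0 < T) (i : Fin N) {f : PhaseSpace M → ℝ}
    (hf : MemLp (fun y : PhaseSpace (N + M) => f (y.1 ∘ Fin.natAdd N, y.2 ∘ Fin.natAdd N)) 2
      ((pinnedChain ω₂ lam β γ).gibbsMeasure (N + M) T)) :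
    ∫ x, f (x.1 ∘ Fin.natAdd N, x.2 ∘ Fin.natAdd N) * (x.2 (Fin.castAdd M i) ^ 2 - T)
      ∂((pinnedChain ω₂ lam β γ).gibbsMeasure (N + M) T) = 0 :=
  integral_mul_sq_sub_gibbsMeasure_eq_zero hω hl hβ γ (N + M) hT (Fin.castAdd M i)
    (fun x t => congrArg f (restrictRight_add_smul_castAdd i x t)) hf

/-- The left bath's source `kin (N+M) 0` is `p_i²` at the left-block site `i = Fin.castAdd M ⟨0, _⟩`
(`N ≥ 1`). [folklore] -/
theorem kin_zero_eq_sq_castAdd (hN : 1 ≤ N) (x : PhaseSpace (N + M)) :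
    kin (N + M) 0 x = x.2 (Fin.castAdd M ⟨0, by omega⟩) ^ 2 := by
  rw [kin_eq_sq (show 0 < N + M by omega)]
  rfl

/-- The right bath's source is the same observable on the right block and on the device:
`p_{M−1}²` of `π'_M x` is `p_{N+M−1}²` of `x` (`M ≥ 1`). [folklore] -/
theorem kin_last_restrictRight (hM : 1 ≤ M) (x : PhaseSpace (N + M)) :
    kin M (M - 1) (x.1 ∘ Fin.natAdd N, x.2 ∘ Fin.natAdd N) = kin (N + M) (N + M - 1) x := by
  have h : (⟨N + M - 1, by omega⟩ : Fin (N + M)) = Fin.natAdd N ⟨M - 1, by omega⟩ :=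
    Fin.ext (by simp; omega)
  rw [kin_eq_sq (show M - 1 < M by omega), kin_eq_sq (show N + M - 1 < N + M by omega), h]
  rfl

/-- **Mirror image: the correction `δ' = g_3 − g^{(M)} ∘ π'_M` of the RIGHT bath's device field by the
bare right block's right-bath field solves the device Poisson problem with the junction source of
the opposite sign**: `L_dev δ' = +(r_J + β r_J³) · (∂_{p_N} g^{(M)}) ∘ π'_M` (`∂_{p_N}` = the block's
`∂_{p_0}`). [folklore] -/
theorem deviceGenerator_sub_comp_restrictRight (γ : ℝ) (hN : 1 ≤ N) (hM : 1 ≤ M) (T : ℝ)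
    {g₃ : PhaseSpace (N + M) → ℝ} {gM : PhaseSpace M → ℝ} (hg₃ : ContDiff ℝ 2 g₃)
    (hgM : ContDiff ℝ 2 gM)
    (hpde₃ : ∀ x, deviceGenerator (pinnedChain ω₂ lam β γ) N M (fun _ => T) g₃ x =
      -(kin (N + M) (N + M - 1) x - T))
    (hpdeM : ∀ y, (pinnedChain ω₂ lam β γ).generator M T T gM y = -(kin M (M - 1) y - T))
    (x : PhaseSpace (N + M)) :
    deviceGenerator (pinnedChain ω₂ lam β γ) N M (fun _ => T)
        (fun y => g₃ y - gM (y.1 ∘ Fin.natAdd N, y.2 ∘ Fin.natAdd N)) x =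
      ((x.1 ⟨N, by omega⟩ - x.1 ⟨N - 1, by omega⟩) +
          β * (x.1 ⟨N, by omega⟩ - x.1 ⟨N - 1, by omega⟩) ^ 3) *
        partialP ⟨0, by omega⟩ gM (x.1 ∘ Fin.natAdd N, x.2 ∘ Fin.natAdd N) := by
  have hdev : deviceGenerator (pinnedChain ω₂ lam β γ) N M (fun _ => T)
      (fun y => gM (y.1 ∘ Fin.natAdd N, y.2 ∘ Fin.natAdd N)) x =
      (pinnedChain ω₂ lam β γ).generator M T T gM (x.1 ∘ Fin.natAdd N, x.2 ∘ Fin.natAdd N) -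
        ((x.1 ⟨N, by omega⟩ - x.1 ⟨N - 1, by omega⟩) +
            β * (x.1 ⟨N, by omega⟩ - x.1 ⟨N - 1, by omega⟩) ^ 3) *
          partialP ⟨0, by omega⟩ gM (x.1 ∘ Fin.natAdd N, x.2 ∘ Fin.natAdd N) :=
    pinnedChain_device_comp_restrictRight ω₂ lam β γ hN hM (fun _ => T) gM x
  rw [deviceGenerator_sub _ T hg₃ (contDiff_comp_restrictRight hgM), hdev, hpde₃, hpdeM,
    kin_last_restrictRight hM]
  ring

/-- **Mirror image: the left bath's pairing with `g_3` is carried by the correction `δ'`.** [folklore] -/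
theorem integral_sub_comp_restrictRight_mul_kin_sub (hω : 0 < ω₂) (hl : 0 ≤ lam) (hβ : 0 ≤ β)
    (γ : ℝ) (hN : 1 ≤ N) {T : ℝ} (hT : 0 < T) {g₃ : PhaseSpace (N + M) → ℝ}
    {gM : PhaseSpace M → ℝ} (hg₃ : MemLp g₃ 2 ((pinnedChain ω₂ lam β γ).gibbsMeasure (N + M) T))
    (hgM : MemLp (fun y : PhaseSpace (N + M) => gM (y.1 ∘ Fin.natAdd N, y.2 ∘ Fin.natAdd N)) 2
      ((pinnedChain ω₂ lam β γ).gibbsMeasure (N + M) T)) :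
    ∫ x, (g₃ x - gM (x.1 ∘ Fin.natAdd N, x.2 ∘ Fin.natAdd N)) * (kin (N + M) 0 x - T)
        ∂((pinnedChain ω₂ lam β γ).gibbsMeasure (N + M) T) =
      ∫ x, g₃ x * (kin (N + M) 0 x - T) ∂((pinnedChain ω₂ lam β γ).gibbsMeasure (N + M) T) := by
  set i : Fin (N + M) := Fin.castAdd M ⟨0, by omega⟩ with hi
  have hk : MemLp (fun x : PhaseSpace (N + M) => x.2 i ^ 2 - T) 2
      ((pinnedChain ω₂ lam β γ).gibbsMeasure (N + M) T) := by
    haveI := pinnedChain_isProbabilityMeasure_gibbsMeasure hω hl hβ γ (N + M) hT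
    exact (pinnedChain_memLp_two_snd_sq hω hl hβ γ (N + M) hT i).sub (memLp_const T)
  have i0 : Integrable (fun x => g₃ x * (x.2 i ^ 2 - T))
      ((pinnedChain ω₂ lam β γ).gibbsMeasure (N + M) T) := hg₃.integrable_mul hk
  have iM : Integrable (fun x : PhaseSpace (N + M) =>
      gM (x.1 ∘ Fin.natAdd N, x.2 ∘ Fin.natAdd N) * (x.2 i ^ 2 - T))
      ((pinnedChain ω₂ lam β γ).gibbsMeasure (N + M) T) := hgM.integrable_mul hk
  have hzero : ∫ x, gM (x.1 ∘ Fin.natAdd N, x.2 ∘ Fin.natAdd N) * (x.2 i ^ 2 - T)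
      ∂((pinnedChain ω₂ lam β γ).gibbsMeasure (N + M) T) = 0 :=
    integral_comp_restrictRight_mul_sq_sub hω hl hβ γ hT ⟨0, by omega⟩ hgM
  simp_rw [kin_zero_eq_sq_castAdd hN]
  have hsplit : (fun x : PhaseSpace (N + M) =>
      (g₃ x - gM (x.1 ∘ Fin.natAdd N, x.2 ∘ Fin.natAdd N)) * (x.2 i ^ 2 - T)) =
      fun x => g₃ x * (x.2 i ^ 2 - T) -
        gM (x.1 ∘ Fin.natAdd N, x.2 ∘ Fin.natAdd N) * (x.2 i ^ 2 - T) := by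
    funext x; ring
  rw [hsplit, integral_sub i0 iM, hzero, sub_zero]

/-- Registered helper sub-goal `helper_bypassJunctionForcing` of stub `stub_bypassBound`
(= `deviceGenerator_sub_comp_restrictLeft` in stub form): the junction-forced Poisson problem of the
correction `g_0 − g^{(N)} ∘ π_N`. [folklore] -/
theorem helper_bypassJunctionForcing : ∀ {ω₂ lam β : ℝ} {N M : ℕ} (γ : ℝ) (hN : 1 ≤ N) (hM : 1 ≤ M) (T : ℝ) {g₀ : PhaseSpace (N + M) → ℝ} {gN : PhaseSpace N → ℝ}, ContDiff ℝ 2 g₀ → ContDiff ℝ 2 gN → (∀ x, deviceGenerator (pinnedChain ω₂ lam β γ) N M (fun _ => T) g₀ x = -(kin (N + M) 0 x - T)) → (∀ y, (pinnedChain ω₂ lam β γ).generator N T T gN y = -(kin N 0 y - T)) → ∀ x : PhaseSpace (N + M), deviceGenerator (pinnedChain ω₂ lam β γ) N M (fun _ => T) (fun y => g₀ y - gN (y.1 ∘ Fin.castAdd M, y.2 ∘ Fin.castAdd M)) x = -(((x.1 ⟨N, by omega⟩ - x.1 ⟨N - 1, by omega⟩) + β * (x.1 ⟨N, by omega⟩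 - x.1 ⟨N - 1, by omega⟩) ^ 3) * partialP ⟨N - 1, by omega⟩ gN (x.1 ∘ Fin.castAdd M, x.2 ∘ Fin.castAdd M)) :=
  fun γ hN hM T _ _ hg₀ hgN hpde₀ hpdeN x =>
    deviceGenerator_sub_comp_restrictLeft γ hN hM T hg₀ hgN hpde₀ hpdeN x

end Junction

end Summit.AtomisticToContinuum.FouriersLaw.Cruxes.SuperadditiveResistance.FloatingProbeBypassLaplacian

end
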